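import Summits.ResolutionOfSingularities.ResolutionOfSingularities.Theorems.PurelyInseparableDim4ResConeLLightStationary
import Summits.ResolutionOfSingularities.ResolutionOfSingularities.Theorems.PurelyInseparableDim4ResConePureCornerTail
import Summits.ResolutionOfSingularities.ResolutionOfSingularities.Theorems.PurelyInseparableDim4ResConePowerConeFormSupport
import Summits.ResolutionOfSingularities.ResolutionOfSingularities.Theorems.PurelyInseparableDim4ResConeHeavyEntryFrame
import HarnessLib

/-!
# Purely inseparable four-folds — L-LIGHT KILL, part F5 (assembly): NO ISOLATED WITNESSED TAIL WITH TWO CHART LETTERS, ONE TRANSLATED FREE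
# LETTER AND AN UNTRANSLATED, UNCHARTED LETTER DIVIDING `F` — every prime `p` (cell `res-dim4-pi`, K2(p) lane, the open loss-free `e = 3`
# cell «L-light twins with a translated free letter»; seat res-dim4-p-9 g6; HOME-only under desk R-251)

[OURS · counted 0 · cell `res-dim4-pi` · K2(p) lane.  TEXT: `res-dim4-p-9/memo/L-LIGHT-KILL-g6.md` f1e59196ba277793, A-read SOUND by
res-dim4-p-5 g7 (K-P5g7-02, `res-dim4-p-5/memo/L-LIGHT-CELL-g7-ADDENDUM.md` 2561d96b32c0aed2).]  **HONEST LABEL.**  A theorem about OUR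
MODEL (the coordinate point-blow-up walk `Step0 p` with cleaning, ISOLATED regime).  Nothing here proves K2(7), K2(p), any TAIL(p, d, 3) as
booked, `NoIsolatedTrap p p`, CJS 6.40 or resolution of singularities in dimension ≥ 4 / characteristic `p` — NOT proved.  AI kernel work,
weaker than expert review.

**`no_twoChart_oneFree_tail (p)`**: over a field of characteristic `p` there is NO witnessed `Step0 p` chain of ISOLATED states (`hc`, `hw` — the
RAW package of `no_pureCorner_tail`) which, from some time `k₀` on, (H2) charts only two letters `A`, `B`; (H3) translates only a third letter `φ`
(`b k i = 0` for `i ≠ φ`); (H4) has a fourth letter `ν` whose exponent is `≥ 1` in every monomial; (H5) stays above the floor (`|E| ≥ p + 1` for every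
monomial).  These are exactly the structure consequences the lane derived for a LOSS-FREE L-SECTOR power-cone tail with a free letter (twins `A, B`
by res-dim4-p-2's `lossfree_frozen_twins`, permanent cone letter `ν` by res-dim4-p-1's `exists_frozen_formSupport_of_L`, FT, band) — the one
loss-free `e = 3` cell the K2(p) FINAL MAP 6a63d0703968a19d §2B leaves OPEN; lightness `n + 3 ≤ d` is not used.
PROOF (memo §1–§5 = parts F1–F4 of this module): ν-slices decouple and the uncleaned ones obey the exact law (F4 `slicePoly_step`); isolation
gives a free-axis witness in a slice `1 ≤ v ≤ p − 1` at every time, one slice `v*` infinitely often (pigeonhole); on that slice the triple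
`(α_A, α_B, o)` obeys F2's bookkeeping, the cofactor order `e = o − α_A − α_B − v*` is eventually constant, and F2's corner TRICHOTOMY leaves only the
STATIONARY case `α_A = α_B = p − v* − e` (escaping slices stop witnessing), with `1 ≤ e ≤ p − 2`; at an `A → B` transition F3's row lemma (twice)
puts `x_A^x x_B^x x_ν^{v*} x_φ^e` into the slice; then F1's weight-one finiteness for `w_k := D_φ^{(e−1)}(slice)` (law by F4/p677284) forces
`b k = 0` for all large `k`, and res-dim4-p-5 g6's `no_pureCorner_tail` (p723217) ends the tail.
[cite: Hauser2010, §§F–G, §I] [cite: HauserPerlega2019PRIMS, §2] [cite: CossartJannsenSaito2020, Lemma 13.2, Thm. 3.14] [cite: EGAIV4, Thm. 16.11.2]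
bears_on: LADDER-RESOLUTION:D157-DOOR2 (res-dim4-pi · K2(p) loss-free e = 3 L-light cell · kill).  Supports stmt-ResolutionOfSingularities-16155
(helper).
-/

set_option linter.dupNamespace false -- mandated namespace of this single-conjunct summit

noncomputable section

namespace Summit.ResolutionOfSingularities.ResolutionOfSingularities.Theorems.PIDim4

namespace ResCone

namespace LLight

open MvPolynomial Finset
open Literature.AlgebraicGeometry.Resolution
open Literature.AlgebraicGeometry.Resolution.CentreBlowup
open Literature.AlgebraicGeometry.Resolution.Hauser2010

variable {K : Type} [Field K]

/-! ## The theorem -/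

/-- **NO ISOLATED WITNESSED TAIL WITH TWO CHART LETTERS, ONE TRANSLATED FREE LETTER AND AN UNTRANSLATED UNCHARTED LETTER DIVIDING `F`**
(module docstring; every prime `p`).  In particular the loss-free L-sector power-cone tails with a translated free letter of the K2(p) ledger —
the L-LIGHT cell — are empty in OUR frame. [OURS · memo L-LIGHT-KILL-g6 §1–§5]
[cite: CossartJannsenSaito2020, Lemma 13.2, Thm. 3.14] [cite: Hauser2010, §§F–G, §I] [cite: HauserPerlega2019PRIMS, §2] -/
theorem no_twoChart_oneFree_tail (p : ℕ) [Fact p.Prime] [CharP K p] [DecidableEq K]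
    {c : ℕ → State K} {j : ℕ → Fin 4} {b : ℕ → Fin 4 → K}
    (hc : ∀ k, IsIsolated p (c k).F ∧ Step0 p (c k) (c (k + 1))) (hw : FreeTail.IsWitnessedChain p c j b)
    {A B ν φ : Fin 4} (hAB : A ≠ B) (hAν : A ≠ ν) (hAφ : A ≠ φ) (hBν : B ≠ ν) (hBφ : B ≠ φ) (hνφ : ν ≠ φ)
    {k₀ : ℕ} (hj : ∀ k, k₀ ≤ k → j k = A ∨ j k = B) (hb : ∀ k, k₀ ≤ k → ∀ i, i ≠ φ → b k i = 0)
    (hν1 : ∀ k, k₀ ≤ k → ∀ E ∈ (c k).F.support, 1 ≤ E ν)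
    (hfl : ∀ k, k₀ ≤ k → ∀ E ∈ (c k).F.support, p + 1 ≤ E.degree) : False := by
  classical
  obtain ⟨v, ks, x, e, k₁, hv1, hvp, hks, hk₁, he1, hpve, hk₁A, hk₁B, hsupp, hcorner⟩ :=
    stationary_witness_slice p hc hw hAB hAν hAφ hBν hBφ hνφ hj hb hν1 hfl
  -- chain facts
  have hjν : ∀ k, k₀ ≤ k → j k ≠ ν := fun k hk h => by
    rcases hj k hk with h' | h'
    · exact hAν (h'.symm.trans h)
    · exact hBν (h'.symm.trans h)
  have hjφ : ∀ k, k₀ ≤ k → j k ≠ φ := fun k hk h => by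
    rcases hj k hk with h' | h'
    · exact hAφ (h'.symm.trans h)
    · exact hBφ (h'.symm.trans h)
  have hbj : ∀ k, b k (j k) = 0 := fun k => (hw k).2.1
  have hq : ∀ k, (p : ℕ∞) ≤ ordAlong Finset.univ (c k).F := fun k => (hw k).1
  have hstep : ∀ k, c (k + 1) = CentreBlowup.step p Finset.univ (j k) (b k) (c k) := fun k => (hw k).2.2.2.2
  have hbsingle : ∀ k, k₀ ≤ k → b k = Pi.single φ (b k φ) := fun k hk => by
    funext i
    by_cases hi : i = φ
    · rw [hi, Pi.single_eq_same]
    · rw [Pi.single_eq_of_ne hi, hb k hk i hi]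
  have hAio : ∀ N, ∃ k, N ≤ k ∧ j k = A := fun N => by
    obtain ⟨k, hk, hne⟩ := chart_change_after hc hw (max N k₀)
    rcases hj k (le_of_max_le_right hk) with h | h
    · exact ⟨k, le_of_max_le_left hk, h⟩
    · rcases hj (k + 1) ((le_of_max_le_right hk).trans (Nat.le_succ k)) with h' | h'
      · exact ⟨k + 1, (le_of_max_le_left hk).trans (Nat.le_succ k), h'⟩
      · exact absurd (h'.trans h.symm) hne
  have hBio : ∀ N, ∃ k, N ≤ k ∧ j k = B := fun N => by
    obtain ⟨k, hk, hne⟩ := chart_change_after hc hw (max N k₀)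
    rcases hj k (le_of_max_le_right hk) with h | h
    · rcases hj (k + 1) ((le_of_max_le_right hk).trans (Nat.le_succ k)) with h' | h'
      · exact absurd (h'.trans h.symm) hne
      · exact ⟨k + 1, (le_of_max_le_left hk).trans (Nat.le_succ k), h'⟩
    · exact ⟨k, le_of_max_le_left hk, h⟩
  -- the slice and its exact law (F4)
  have hvdvd : ¬ p ∣ v := fun h => by have := Nat.le_of_dvd (by omega) h; omega
  set G : ℕ → MvPolynomial (Fin 4) K := fun k => ∑ d ∈ (c k).F.support with d ν = v, monomial d (coeff d (c k).F) with hG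
  have hGsupp : ∀ k E, E ∈ (G k).support ↔ E ∈ (c k).F.support ∧ E ν = v := fun k E => by rw [hG]; exact mem_support_slicePoly
  have hGlaw : ∀ k, k₀ ≤ k → G (k + 1) = chartTransform p Finset.univ (j k) (Hauser2010.shear (j k) (Pi.single φ (b k φ)) (G k)) := by
    intro k hk
    have h := slicePoly_step p (hjν k hk).symm (hbj k) (hb k hk ν hνφ) (c k) (hq k) hvdvd
    rw [← hstep k] at h
    rw [hG]
    simp only
    rw [h, ← hbsingle k hk]
  -- §5 maximal contact by the free letter: the weight-one chain `w k := D_φ^{(e−1)} (G k)` (F1)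
  set r₀ : Fin 4 →₀ ℕ := Finsupp.single A x + Finsupp.single B x + Finsupp.single ν v with hr₀
  have hsimp := And.intro hAB (And.intro hAB.symm (And.intro hAν (And.intro hAν.symm (And.intro hAφ (And.intro hAφ.symm
    (And.intro hBν (And.intro hBν.symm (And.intro hBφ (And.intro hBφ.symm (And.intro hνφ hνφ.symm))))))))))
  have hr₀A : r₀ A = x := by rw [hr₀]; simp [hsimp]
  have hr₀B : r₀ B = x := by rw [hr₀]; simp [hsimp]
  have hr₀ν : r₀ ν = v := by rw [hr₀]; simp [hsimp]
  have hr₀φ : r₀ φ = 0 := by rw [hr₀]; simp [hsimp]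
  have hr₀deg : r₀.degree = 2 * x + v := by
    rw [hr₀, map_add, map_add, Finsupp.degree_single, Finsupp.degree_single, Finsupp.degree_single]; ring
  set w : ℕ → MvPolynomial (Fin 4) K := fun k => hasseDeriv (Finsupp.single φ (e - 1)) (G k) with hwdef
  have hQ : (p - (e - 1)) + r₀ A = r₀.degree + 1 := by rw [hr₀A, hr₀deg]; omega
  have hwlaw : ∀ k, k₁ + 1 ≤ k →
      w (k + 1) = chartTransform (p - (e - 1)) Finset.univ (j k) (Hauser2010.shear (j k) (Pi.single φ (b k φ)) (w k)) := by
    intro k hk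
    have hk0 : k₀ ≤ k := by omega
    simp only [hwdef]
    rw [hGlaw k hk0, hasseDeriv_single_chartTransform_shear (hjφ k hk0).symm (by omega)]
  have hwabove : ∀ k, k₁ + 1 ≤ k → ∀ E ∈ (w k).support, r₀ ≤ E ∧ E ≠ r₀ := by
    intro k hk E hE
    have hd := add_single_mem_support_of_mem_support_hasseDeriv hE
    set d := E + Finsupp.single φ (e - 1) with hdd
    obtain ⟨hdF, hdν⟩ := (hGsupp k d).mp hd
    obtain ⟨hdA, hdB, hddeg⟩ := hsupp k (by omega) d hdF hdν
    have hEi : ∀ i, i ≠ φ → E i = d i := fun i hi => by rw [hdd, Finsupp.add_apply, Finsupp.single_eq_of_ne hi, add_zero]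
    have hEdeg : E.degree + (e - 1) = d.degree := by rw [hdd, map_add, Finsupp.degree_single]
    refine ⟨fun i => ?_, fun hEr => ?_⟩
    · by_cases hiφ : i = φ
      · rw [hiφ, hr₀φ]; exact Nat.zero_le _
      · rw [hEi i hiφ]
        rcases letters_exhaust hAB hAν hAφ hBν hBφ hνφ i with h | h | h | h
        · rw [h, hr₀A]; exact hdA
        · rw [h, hr₀B]; exact hdB
        · rw [h, hr₀ν, hdν]
        · exact absurd h hiφ
    · rw [hEr, hr₀deg] at hEdeg; omega
  have hwφ : coeff (r₀ + Finsupp.single φ 1) (w (k₁ + 1)) ≠ 0 := by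
    have hexp1 : r₀ + Finsupp.single φ 1 + Finsupp.single φ (e - 1) = r₀ + Finsupp.single φ e := by
      rw [add_assoc, ← Finsupp.single_add, show 1 + (e - 1) = e by omega]
    have hch : ((((r₀ + Finsupp.single φ 1 : Fin 4 →₀ ℕ) φ + (e - 1)).choose (e - 1) : ℕ) : K) ≠ 0 := by
      rw [Finsupp.add_apply, hr₀φ, Finsupp.single_eq_same, zero_add, show 1 + (e - 1) = (e - 1) + 1 by omega,
        Nat.choose_succ_self_right, show e - 1 + 1 = e by omega]
      intro h
      have h1 := (CharP.cast_eq_zero_iff K p e).mp h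
      have h2 := Nat.le_of_dvd (by omega) h1
      omega
    have hcG : r₀ + Finsupp.single φ e ∈ (G (k₁ + 1)).support := by
      refine (hGsupp (k₁ + 1) _).mpr ⟨?_, ?_⟩
      · rw [hr₀]; exact hcorner
      · rw [Finsupp.add_apply, hr₀ν, Finsupp.single_eq_of_ne hνφ, add_zero]
    simp only [hwdef]
    rw [coeff_hasseDeriv_single, hexp1]
    exact mul_ne_zero hch (MvPolynomial.mem_support_iff.mp hcG)
  obtain ⟨T, hT⟩ := weightOne_translations_eventually_zero (A := A) (B := B) (φ := φ) (r₀ := r₀) (Q := p - (e - 1)) (w := w)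
    (j := j) (β := fun k => b k φ) (m := k₁ + 1) hAφ hBφ hr₀φ (hr₀A.trans hr₀B.symm) hQ (fun k hk => hj k (by omega)) hwlaw hwabove
    hAB hwφ hAio hBio
  -- §6 the tail is a pure-corner tail from `max T k₀` on: contradiction
  refine no_pureCorner_tail p hc hw (k₀ := max T k₀) fun k hk => ?_
  funext i
  by_cases hi : i = φ
  · rw [hi]; exact hT k (le_of_max_le_left hk)
  · exact hb k (le_of_max_le_right hk) i hi

/-! ## The L-light cell of the K2(p) ledger -/

/-- **THE LOSS-FREE L-SECTOR POWER-CONE TAIL WITH A FREE LETTER IS EMPTY, every prime `p`, every shade `d`** (the «L-light» cell of the K2(p)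
FINAL MAP 6a63d0703968a19d §2B, in the RAW package of res-dim4-p-5 g6's `lossfree_lSector_twin_weight_add_three_le` minus the unused form /
`2 ≤ d` hypotheses): a witnessed isolated above-floor `Step0 p` chain with `x^{r₀} ∣ F₀` and constant shade `d` from `k₀`, carrying power-cone
data (`ℓ k ≠ 0`, direction equation, propagation), LOSS-FREE from `k₀`, in the L-SECTOR from `k₀`, and with a FREE letter at every late time,
does not exist.  (Structure: frozen twins `A, B` = the late chart letters — res-dim4-p-2 `lossfree_frozen_twins`; a permanent cone letter `ν`,
never charted, never translated, weight `≥ 1` — res-dim4-p-1 `exists_frozen_formSupport_of_L`; the free letter `φ` is the only weight-`0`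
letter, hence the only translated one; band `ord > p`; then `no_twoChart_oneFree_tail`.) [OURS]
[cite: CossartJannsenSaito2020, Thm. 3.14, Lemma 13.2] [cite: HauserPerlega2019PRIMS, §2 (transform D′ of D)] [cite: Hauser2010, §§F–G] -/
theorem no_lossfree_lSector_tail_with_free_letter (p : ℕ) [Fact p.Prime] [CharP K p] [DecidableEq K]
    {c : ℕ → State K} {j : ℕ → Fin 4} {b : ℕ → Fin 4 → K}
    (hc : ∀ k, IsIsolated p (c k).F ∧ Step0 p (c k) (c (k + 1))) (hw : FreeTail.IsWitnessedChain p c j b)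
    (hr0 : ∀ e ∈ (c 0).F.support, (c 0).r ≤ e) (hfloor : ∀ k, ordZero (c k).F ≠ p) {k₀ d : ℕ}
    (hshade : ∀ k, k₀ ≤ k → (c k).shade = (d : ℕ∞))
    {ℓ : ℕ → Fin 4 → K} {lam : ℕ → K} (hℓ0 : ∀ k, k₀ ≤ k → ℓ k ≠ 0)
    (hdir : ∀ k, k₀ ≤ k → ℓ k (j k) + dotProduct (ℓ k) (b k) = 0) (hlam : ∀ k, k₀ ≤ k → lam k ≠ 0)
    (hprop : ∀ k, k₀ ≤ k → ∀ i, i ≠ j k → ℓ (k + 1) i = lam k * ℓ k i)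
    (hloss : ∀ k, k₀ ≤ k → ∀ i, b k i ≠ 0 → (c k).r i = 0)
    (hL : ∀ k, k₀ ≤ k → ∀ i, (c k).r i = 0 → ℓ k i = 0)
    (hfree : ∀ k, k₀ ≤ k → ∃ φ, (c k).r φ = 0) : False := by
  classical
  obtain ⟨-, -, -, hband, -⟩ := tail_weights_laws hc hw hr0 hfloor hshade
  -- frozen weights; every late chart letter has the twin weight `n ≥ 1`
  obtain ⟨K₁, hK₁, hconst, hchart, -⟩ := lossfree_frozen_twins hc hw hr0 hfloor hshade hloss
  -- the frozen form support: a permanent letter `ν`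
  obtain ⟨k₂, hk₂, N, ⟨ν, hνN⟩, -, -, hperm⟩ := exists_frozen_formSupport_of_L p hc hw hfloor hℓ0 hdir hlam hprop (le_refl k₀) hL
  set K₂ : ℕ := max K₁ k₂ with hK₂
  have hK₂1 : K₁ ≤ K₂ := le_max_left _ _
  have hK₂2 : k₂ ≤ K₂ := le_max_right _ _
  have hK₂0 : k₀ ≤ K₂ := hK₁.trans hK₂1
  -- the free letter `φ` (weight `0` for ever)
  obtain ⟨φ, hφ⟩ := hfree K₁ hK₁
  have hrφ : ∀ k, K₁ ≤ k → (c k).r φ = 0 := fun k hk => by rw [hconst k hk]; exact hφ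
  have hn1 : 1 ≤ (c K₁).r.degree + d - p := by have := (hband K₁ hK₁).1; omega
  -- two distinct late chart letters `A, B`
  obtain ⟨m, hm, hAB'⟩ := chart_change_after hc hw K₂
  set A : Fin 4 := j m with hA
  set B : Fin 4 := j (m + 1) with hB
  have hrA : (c K₁).r A = (c K₁).r.degree + d - p := hchart m (hK₂1.trans hm)
  have hrB : (c K₁).r B = (c K₁).r.degree + d - p := hchart (m + 1) ((hK₂1.trans hm).trans (Nat.le_succ m))
  have hrν : 1 ≤ (c K₁).r ν := by have := (hperm ν hνN K₂ hK₂2).1; rwa [hconst K₂ hK₂1] at this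
  have hAB : A ≠ B := fun h => hAB' (h.symm ▸ rfl)
  have hAφ : A ≠ φ := fun h => by have := hrφ K₁ le_rfl; rw [← h, hrA] at this; omega
  have hBφ : B ≠ φ := fun h => by have := hrφ K₁ le_rfl; rw [← h, hrB] at this; omega
  have hνφ : ν ≠ φ := fun h => by have := hrφ K₁ le_rfl; rw [← h] at this; omega
  have hAν : A ≠ ν := fun h => (hperm ν hνN m (hK₂2.trans hm)).2.1 h
  have hBν : B ≠ ν := fun h => (hperm ν hνN (m + 1) ((hK₂2.trans hm).trans (Nat.le_succ m))).2.1 h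
  have hletters : ∀ i : Fin 4, i = A ∨ i = B ∨ i = ν ∨ i = φ := letters_exhaust hAB hAν hAφ hBν hBφ hνφ
  -- (H2) late charts are `A` or `B`
  have hj : ∀ k, K₂ ≤ k → j k = A ∨ j k = B := by
    intro k hk
    rcases hletters (j k) with h | h | h | h
    · exact Or.inl h
    · exact Or.inr h
    · exact absurd h (hperm ν hνN k (hK₂2.trans hk)).2.1
    · exfalso
      have h1 := hchart k (hK₂1.trans hk)
      rw [h, hφ] at h1; omega
  -- (H3) only `φ` is translated
  have hb : ∀ k, K₂ ≤ k → ∀ i, i ≠ φ → b k i = 0 := by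
    intro k hk i hi
    by_contra hne
    have h0 := hloss k (hK₂0.trans hk) i hne
    rw [hconst k (hK₂1.trans hk)] at h0
    rcases hletters i with h | h | h | h
    · rw [h, hrA] at h0; omega
    · rw [h, hrB] at h0; omega
    · rw [h] at h0; omega
    · exact hi h
  -- (H4) `ν` divides every monomial, (H5) above the floor
  have hν1 : ∀ k, K₂ ≤ k → ∀ E ∈ (c k).F.support, 1 ≤ E ν := fun k hk E hE =>
    (hperm ν hνN k (hK₂2.trans hk)).1.trans (IsolatedBand.isolated_chain_forall_le hc hr0 k E hE ν)
  have hfl : ∀ k, K₂ ≤ k → ∀ E ∈ (c k).F.support, p + 1 ≤ E.degree := by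
    intro k hk E hE
    obtain ⟨o, ho, hpo, -⟩ := chain_band p hc hfloor k
    have := le_degree_of_mem_support_of_ordZero ho hE
    omega
  exact no_twoChart_oneFree_tail p hc hw hAB hAν hAφ hBν hBφ hνφ hj hb hν1 hfl

end LLight

end ResCone

end Summit.ResolutionOfSingularities.ResolutionOfSingularities.Theorems.PIDim4

end
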